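import Summits.KontsevichZagierPeriods.KontsevichZagierPeriods.Theorems.RealOnePeriodRelations.Negative.Kit
import Summits.KontsevichZagierPeriods.KontsevichZagierPeriods.Theorems.SymplecticScissorsRealOnePeriodRelationsStubHomotopyInvarianceAux
import Literature.NumberTheory.Transcendental.CurvePeriodsProofs

/-!
# `RealOnePeriodRelations` (stmt-KontsevichZagierPeriods-10042), line `nash-retraction-thin-strip`:
# algebra of the retraction `Θ` (helper file for the stubs `stub_retraction` and `stub_normalisation`)

The retraction `Θ` of the line sends `b · (Z, ω, γ)` (a Huber–Wüstholz period symbol scaled by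
an algebraic number `b`) to a real 1-dimensional Kontsevich–Zagier representation whose
integrand is `t ↦ Re(b · Σᵢ ωᵢ(γ̃(t)) γ̃ᵢ′(t))` along a semialgebraic path `γ̃`. This file contains
the purely formal part of the bookkeeping, with no geometry:

* §1 elementary consequences of rule 1b (`KZ.integrandAddRel`) inside
  `M₁ = closure(1a ∪ 1b ∪ 2 ∪ Green)` (representations with vanishing integrand lie in `M₁`:
  `HomotopyInvariance.of_mem_of_integrand_zero`, imported from the sibling file of the line):
  representations with the same domain and integrands agreeing on it are congruent; additivity;
* §2 REALISATIONS ALONG ONE FIXED PATH: two realisations of the same data are congruent modulo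
  `M₁`; additivity in the scalar and in the form; `Re(b·(a′ω)) = Re((a′b)·ω)`; vanishing scalar;
  forms vanishing on the tangent spaces of `Z` realise to `0` (the velocity of a `C¹` path on `Z`
  is tangent, `CurvePath.deriv_mem_tangentSpace`);
* §3 the additive extension to finitely supported `ℚ̄`-combinations of symbols: for any
  `Θ : ℂ → PeriodSymbol → FormalRep` which is additive in the scalar modulo `M₁` on algebraic
  scalars and kills the scalar `0`, the map `c ↦ Σ_{s ∈ supp c} Θ (c s) s` into `FormalRep ⧸ M₁` is
  additive on combinations with algebraic coefficients and sends `b • δ_s` to `Θ b s` — so that a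
  combination written as a formal sum `Σⱼ bⱼ • δ_{sⱼ}` with possibly REPEATED symbols is sent to
  `Σⱼ Θ bⱼ sⱼ` (no case distinction on coincidences of symbols is ever needed).

References: M. Kontsevich, D. Zagier, *Periods* (2001), §1.2; A. Huber, G. Wüstholz,
*Transcendence and Linear Relations of 1-Periods* (2022), §13.1, Thm 13.3 (2).
-/

noncomputable section

open scoped BigOperators
open Set MeasureTheory MvPolynomial
open Literature.NumberTheory.Transcendental Literature.NumberTheory.Transcendental.CurvePeriods
open Summit.KontsevichZagierPeriods.SymplecticScissors.RealOnePeriodRelationsNegative (M₁ greenSet)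

namespace Summit.KontsevichZagierPeriods.SymplecticScissors.RealOnePeriodRelations

namespace RetractionAlgebra

/-! ## §1 Rule 1b inside `M₁` -/

/-- An instance of rule 1b lies in `M₁`. [cite: KontsevichZagier2001, §1.2] -/
theorem mem_M₁_of_mem_integrandAddRel {c : KZ.FormalRep} (hc : c ∈ KZ.integrandAddRel) : c ∈ M₁ :=
  AddSubgroup.subset_closure (Or.inl (Or.inl (Or.inr hc)))

/-- An instance of rule 1a lies in `M₁`. [cite: KontsevichZagier2001, §1.2] -/
theorem mem_M₁_of_mem_domainAddRel {c : KZ.FormalRep} (hc : c ∈ KZ.domainAddRel) : c ∈ M₁ :=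
  AddSubgroup.subset_closure (Or.inl (Or.inl (Or.inl hc)))

/-- An instance of rule 2 lies in `M₁`. [cite: KontsevichZagier2001, §1.2] -/
theorem mem_M₁_of_mem_changeOfVariablesRel {c : KZ.FormalRep} (hc : c ∈ KZ.changeOfVariablesRel) :
    c ∈ M₁ :=
  AddSubgroup.subset_closure (Or.inl (Or.inr hc))

/-- An instance of the Green generator lies in `M₁`. [cite: KontsevichZagier2001, §1.2] -/
theorem mem_M₁_of_mem_greenSet {c : KZ.FormalRep} (hc : c ∈ greenSet) : c ∈ M₁ :=
  AddSubgroup.subset_closure (Or.inr hc)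

/-- **Additivity (rule 1b)**: if `r`, `r₁`, `r₂` have the same domain and `f = f₁ + f₂` on it, then
`[r] − [r₁] − [r₂] ∈ M₁`. [cite: KontsevichZagier2001, §1.2 rule (1)] -/
theorem sub_sub_mem_of_add {n : ℕ} (r r₁ r₂ : KZ.IntegralRep n) (h₁ : r₁.domain = r.domain)
    (h₂ : r₂.domain = r.domain)
    (hadd : ∀ x ∈ r.domain, r.integrand x = r₁.integrand x + r₂.integrand x) :
    KZ.of r - KZ.of r₁ - KZ.of r₂ ∈ M₁ :=
  mem_M₁_of_mem_integrandAddRel ⟨n, r, r₁, r₂, h₁, h₂, fun x hx => hadd x hx, rfl⟩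

/-- **Representations with the same domain whose integrands agree on it are congruent** modulo
`M₁` (rule 1b against a zero-integrand representation). [cite: KontsevichZagier2001, §1.2 rule (1)] -/
theorem sub_mem_of_eqOn {n : ℕ} (r r' : KZ.IntegralRep n) (hdom : r.domain = r'.domain)
    (heq : ∀ x ∈ r.domain, r.integrand x = r'.integrand x) : KZ.of r - KZ.of r' ∈ M₁ := by
  -- the zero representation on the common domain
  let z : KZ.IntegralRep n :=
    { domain := r.domain
      integrand := fun _ => 0
      isSemialgebraic_domain := r.isSemialgebraic_domain
      isSemialgebraicFunOn_integrand :=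
        (Summit.KontsevichZagierPeriods.SymplecticScissors.RealOnePeriodRelationsNegative.isSemialgebraicFunOn_ratConst
          r.isSemialgebraic_domain 0).congr fun _ _ => by simp
      integrableOn := integrableOn_zero }
  have h1 : KZ.of r - KZ.of r' - KZ.of z ∈ M₁ :=
    sub_sub_mem_of_add r r' z hdom.symm rfl fun x hx => by rw [heq x hx]; simp [z]
  have h2 : KZ.of z ∈ M₁ := HomotopyInvariance.of_mem_of_integrand_zero z fun _ _ => rfl
  have h3 := M₁.add_mem h1 h2
  rwa [sub_add_cancel] at h3

/-! ## §2 Realisations along one fixed path -/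

variable {Z : CurveData}

/-- Two realisations of `b · (Z, ω, γ)` along the same path are congruent modulo `M₁`.
[cite: KontsevichZagier2001, §1.2] -/
theorem realises_unique (γ : ℝ → (Fin Z.n → ℂ)) (ω : Fin Z.n → MvPolynomial (Fin Z.n) ℂ) (b : ℂ)
    (r r' : KZ.IntegralRep 1)
    (hr : r.domain = {z | z 0 ∈ Set.Ioo (0 : ℝ) 1} ∧ ∀ z ∈ r.domain, r.integrand z =
      (b * ∑ i, MvPolynomial.eval (γ (z 0)) (ω i) * deriv (fun u => γ u i) (z 0)).re)
    (hr' : r'.domain = {z | z 0 ∈ Set.Ioo (0 : ℝ) 1} ∧ ∀ z ∈ r'.domain, r'.integrand z =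
      (b * ∑ i, MvPolynomial.eval (γ (z 0)) (ω i) * deriv (fun u => γ u i) (z 0)).re) :
    KZ.of r - KZ.of r' ∈ M₁ :=
  sub_mem_of_eqOn r r' (hr.1.trans hr'.1.symm) fun x hx => by
    rw [hr.2 x hx, hr'.2 x (hr'.1 ▸ hr.1 ▸ hx)]

/-- **Additivity in the scalar**: realisations of `(b₁ + b₂)·s`, `b₁·s`, `b₂·s` along the same
path satisfy `[r] − [r₁] − [r₂] ∈ M₁` (`Re` is additive; rule 1b). [cite: KontsevichZagier2001, §1.2] -/
theorem realises_add_scalar (γ : ℝ → (Fin Z.n → ℂ)) (ω : Fin Z.n → MvPolynomial (Fin Z.n) ℂ)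
    (b₁ b₂ : ℂ) (r r₁ r₂ : KZ.IntegralRep 1)
    (hr : r.domain = {z | z 0 ∈ Set.Ioo (0 : ℝ) 1} ∧ ∀ z ∈ r.domain, r.integrand z =
      ((b₁ + b₂) * ∑ i, MvPolynomial.eval (γ (z 0)) (ω i) * deriv (fun u => γ u i) (z 0)).re)
    (hr₁ : r₁.domain = {z | z 0 ∈ Set.Ioo (0 : ℝ) 1} ∧ ∀ z ∈ r₁.domain, r₁.integrand z =
      (b₁ * ∑ i, MvPolynomial.eval (γ (z 0)) (ω i) * deriv (fun u => γ u i) (z 0)).re)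
    (hr₂ : r₂.domain = {z | z 0 ∈ Set.Ioo (0 : ℝ) 1} ∧ ∀ z ∈ r₂.domain, r₂.integrand z =
      (b₂ * ∑ i, MvPolynomial.eval (γ (z 0)) (ω i) * deriv (fun u => γ u i) (z 0)).re) :
    KZ.of r - KZ.of r₁ - KZ.of r₂ ∈ M₁ :=
  sub_sub_mem_of_add r r₁ r₂ (hr₁.1.trans hr.1.symm) (hr₂.1.trans hr.1.symm) fun x hx => by
    rw [hr.2 x hx, hr₁.2 x (hr₁.1 ▸ hr.1 ▸ hx), hr₂.2 x (hr₂.1 ▸ hr.1 ▸ hx), add_mul,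
      Complex.add_re]

/-- **Additivity in the form**: realisations of `b·(Z, ω₁ + ω₂, γ)`, `b·(Z, ω₁, γ)`,
`b·(Z, ω₂, γ)` along the same path satisfy `[r] − [r₁] − [r₂] ∈ M₁`.
[cite: HuberWustholz2022, §13.1 (A)] -/
theorem realises_add_form (γ : ℝ → (Fin Z.n → ℂ)) (ω₁ ω₂ : Fin Z.n → MvPolynomial (Fin Z.n) ℂ)
    (b : ℂ) (r r₁ r₂ : KZ.IntegralRep 1)
    (hr : r.domain = {z | z 0 ∈ Set.Ioo (0 : ℝ) 1} ∧ ∀ z ∈ r.domain, r.integrand z =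
      (b * ∑ i, MvPolynomial.eval (γ (z 0)) ((ω₁ + ω₂) i) * deriv (fun u => γ u i) (z 0)).re)
    (hr₁ : r₁.domain = {z | z 0 ∈ Set.Ioo (0 : ℝ) 1} ∧ ∀ z ∈ r₁.domain, r₁.integrand z =
      (b * ∑ i, MvPolynomial.eval (γ (z 0)) (ω₁ i) * deriv (fun u => γ u i) (z 0)).re)
    (hr₂ : r₂.domain = {z | z 0 ∈ Set.Ioo (0 : ℝ) 1} ∧ ∀ z ∈ r₂.domain, r₂.integrand z =
      (b * ∑ i, MvPolynomial.eval (γ (z 0)) (ω₂ i) * deriv (fun u => γ u i) (z 0)).re) :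
    KZ.of r - KZ.of r₁ - KZ.of r₂ ∈ M₁ :=
  sub_sub_mem_of_add r r₁ r₂ (hr₁.1.trans hr.1.symm) (hr₂.1.trans hr.1.symm) fun x hx => by
    rw [hr.2 x hx, hr₁.2 x (hr₁.1 ▸ hr.1 ▸ hx), hr₂.2 x (hr₂.1 ▸ hr.1 ▸ hx), ← Complex.add_re,
      ← mul_add, ← Finset.sum_add_distrib]
    congr 2
    exact Finset.sum_congr rfl fun i _ => by rw [Pi.add_apply, map_add, add_mul]

/-- **Scalars move into the form**: a realisation of `b·(Z, a′•ω, γ)` and one of `(a′b)·(Z, ω, γ)`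
along the same path have the same integrand, hence are congruent. [cite: HuberWustholz2022, §13.1 (A)] -/
theorem realises_smul_form (γ : ℝ → (Fin Z.n → ℂ)) (ω : Fin Z.n → MvPolynomial (Fin Z.n) ℂ)
    (a' b : ℂ) (r r' : KZ.IntegralRep 1)
    (hr : r.domain = {z | z 0 ∈ Set.Ioo (0 : ℝ) 1} ∧ ∀ z ∈ r.domain, r.integrand z =
      (b * ∑ i, MvPolynomial.eval (γ (z 0)) ((a' • ω) i) * deriv (fun u => γ u i) (z 0)).re)
    (hr' : r'.domain = {z | z 0 ∈ Set.Ioo (0 : ℝ) 1} ∧ ∀ z ∈ r'.domain, r'.integrand z =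
      (a' * b * ∑ i, MvPolynomial.eval (γ (z 0)) (ω i) * deriv (fun u => γ u i) (z 0)).re) :
    KZ.of r - KZ.of r' ∈ M₁ :=
  sub_mem_of_eqOn r r' (hr.1.trans hr'.1.symm) fun x hx => by
    rw [hr.2 x hx, hr'.2 x (hr'.1 ▸ hr.1 ▸ hx)]
    congr 1
    rw [mul_comm a' b, mul_assoc, Finset.mul_sum, Finset.mul_sum, Finset.mul_sum]
    refine Finset.sum_congr rfl fun i _ => ?_
    rw [Pi.smul_apply, smul_eval]
    ring

/-- **The scalar `0` realises into `M₁`** (zero integrand). [cite: KontsevichZagier2001, §1.2] -/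
theorem realises_zero_scalar (γ : ℝ → (Fin Z.n → ℂ)) (ω : Fin Z.n → MvPolynomial (Fin Z.n) ℂ)
    (r : KZ.IntegralRep 1)
    (hr : r.domain = {z | z 0 ∈ Set.Ioo (0 : ℝ) 1} ∧ ∀ z ∈ r.domain, r.integrand z =
      ((0 : ℂ) * ∑ i, MvPolynomial.eval (γ (z 0)) (ω i) * deriv (fun u => γ u i) (z 0)).re) :
    KZ.of r ∈ M₁ :=
  HomotopyInvariance.of_mem_of_integrand_zero r fun x hx => by rw [hr.2 x hx, zero_mul, Complex.zero_re]

/-- **(R2) Forms vanishing on the curve realise into `M₁`**: along a `C¹` path ON `Z` the velocity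
is tangent to `Z` (`CurvePath.deriv_mem_tangentSpace`), so `Σᵢ ωᵢ(γ(t)) γᵢ′(t) = 0` on `(0,1)`
when `ω` vanishes on the tangent spaces of `Z`. [cite: HuberWustholz2022, §13.1 (A)] -/
theorem realises_vanish (γ : CurvePath Z) (ω : Fin Z.n → MvPolynomial (Fin Z.n) ℂ)
    (hv : VanishesOn Z ω) (b : ℂ) (r : KZ.IntegralRep 1)
    (hr : r.domain = {z | z 0 ∈ Set.Ioo (0 : ℝ) 1} ∧ ∀ z ∈ r.domain, r.integrand z =
      (b * ∑ i, MvPolynomial.eval (γ.toFun (z 0)) (ω i) * deriv (fun u => γ.toFun u i) (z 0)).re) :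
    KZ.of r ∈ M₁ :=
  HomotopyInvariance.of_mem_of_integrand_zero r fun x hx => by
    have hx' : x 0 ∈ Set.Ioo (0 : ℝ) 1 := by
      have := hr.1 ▸ hx
      simpa using this
    rw [hr.2 x hx, hv (γ.toFun (x 0)) (γ.mem_points _ (Ioo_subset_Icc_self hx')) _
      (γ.deriv_mem_tangentSpace hx'), mul_zero, Complex.zero_re]

/-! ## §3 The additive extension to `ℚ̄`-combinations of symbols -/

section Extension

variable (Θ : ℂ → PeriodSymbol → KZ.FormalRep)

/-- The class map `FormalRep → FormalRep ⧸ M₁`. [folklore] -/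
local notation "πM₁" => (QuotientAddGroup.mk' M₁ : KZ.FormalRep →+ KZ.FormalRep ⧸ M₁)

/-- `πM₁ x = 0 ↔ x ∈ M₁`. [folklore] -/
theorem mk'_eq_zero_iff (x : KZ.FormalRep) : πM₁ x = 0 ↔ x ∈ M₁ :=
  QuotientAddGroup.eq_zero_iff x

/-- **Enlarging the summation set**: if `Θ 0 s ∈ M₁` for all `s`, the class of
`Σ_{s ∈ supp c} Θ (c s) s` may be computed over any finite superset of the support. [folklore] -/
theorem mk_sum_eq_sum_superset (hΘ0 : ∀ s, Θ 0 s ∈ M₁) (c : PeriodSymbol →₀ ℂ)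
    {S : Finset PeriodSymbol} (hS : c.support ⊆ S) :
    πM₁ (c.sum fun s b => Θ b s) = ∑ s ∈ S, πM₁ (Θ (c s) s) := by
  classical
  rw [Finsupp.sum, map_sum (QuotientAddGroup.mk' M₁)]
  refine Finset.sum_subset hS fun s _ hs => ?_
  rw [Finsupp.notMem_support_iff.mp hs]
  exact (mk'_eq_zero_iff _).mpr (hΘ0 s)

/-- **Additivity on combinations with algebraic coefficients.** [folklore] -/
theorem mk_sum_add (hΘ0 : ∀ s, Θ 0 s ∈ M₁)
    (hΘadd : ∀ (s : PeriodSymbol) (b₁ b₂ : ℂ), IsAlgebraic ℚ b₁ → IsAlgebraic ℚ b₂ →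
      Θ (b₁ + b₂) s - Θ b₁ s - Θ b₂ s ∈ M₁)
    (c₁ c₂ : PeriodSymbol →₀ ℂ) (h₁ : ∀ s, IsAlgebraic ℚ (c₁ s)) (h₂ : ∀ s, IsAlgebraic ℚ (c₂ s)) :
    πM₁ ((c₁ + c₂).sum fun s b => Θ b s) =
      πM₁ (c₁.sum fun s b => Θ b s) + πM₁ (c₂.sum fun s b => Θ b s) := by
  classical
  have hS : (c₁ + c₂).support ⊆ c₁.support ∪ c₂.support := Finsupp.support_add
  rw [mk_sum_eq_sum_superset Θ hΘ0 _ hS,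
    mk_sum_eq_sum_superset Θ hΘ0 c₁ (Finset.subset_union_left (s₂ := c₂.support)),
    mk_sum_eq_sum_superset Θ hΘ0 c₂ (Finset.subset_union_right (s₁ := c₁.support)),
    ← Finset.sum_add_distrib]
  refine Finset.sum_congr rfl fun s _ => ?_
  rw [Finsupp.add_apply, ← map_add, ← sub_eq_zero, ← map_sub, mk'_eq_zero_iff,
    show Θ (c₁ s + c₂ s) s - (Θ (c₁ s) s + Θ (c₂ s) s) =
      Θ (c₁ s + c₂ s) s - Θ (c₁ s) s - Θ (c₂ s) s by abel]
  exact hΘadd s _ _ (h₁ s) (h₂ s)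

/-- **The value on `b • δ_s`.** [folklore] -/
theorem mk_sum_smul_single (hΘ0 : ∀ s, Θ 0 s ∈ M₁) (b : ℂ) (s : PeriodSymbol) :
    πM₁ ((b • Finsupp.single s (1 : ℂ)).sum fun s b => Θ b s) = πM₁ (Θ b s) := by
  classical
  have hS : (b • Finsupp.single s (1 : ℂ)).support ⊆ {s} :=
    Finsupp.support_smul.trans Finsupp.support_single_subset
  rw [mk_sum_eq_sum_superset Θ hΘ0 _ hS, Finset.sum_singleton]
  simp

/-- Coefficients of `b • δ_s` are algebraic when `b` is. [folklore] -/
theorem isAlgebraic_smul_single_apply {b : ℂ} (hb : IsAlgebraic ℚ b) (s s' : PeriodSymbol) :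
    IsAlgebraic ℚ ((b • Finsupp.single s (1 : ℂ)) s') := by
  classical
  rw [Finsupp.smul_apply, Finsupp.single_apply]
  split_ifs
  · simpa using hb
  · simpa using isAlgebraic_zero

/-- Coefficients of a finite sum of combinations with algebraic coefficients are algebraic.
[folklore] -/
theorem isAlgebraic_finset_sum_apply {ι : Type*} (J : Finset ι) (c : ι → PeriodSymbol →₀ ℂ)
    (hc : ∀ j ∈ J, ∀ s, IsAlgebraic ℚ (c j s)) (s : PeriodSymbol) :
    IsAlgebraic ℚ ((∑ j ∈ J, c j) s) := by
  classical
  induction J using Finset.induction_on with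
  | empty => simpa using isAlgebraic_zero
  | insert j J hj ih =>
    rw [Finset.sum_insert hj, Finsupp.add_apply]
    exact (hc j (Finset.mem_insert_self j J) s).add
      (ih fun k hk => hc k (Finset.mem_insert_of_mem hk))

/-- **Additivity over finite sums of combinations with algebraic coefficients.** [folklore] -/
theorem mk_sum_finset_sum (hΘ0 : ∀ s, Θ 0 s ∈ M₁)
    (hΘadd : ∀ (s : PeriodSymbol) (b₁ b₂ : ℂ), IsAlgebraic ℚ b₁ → IsAlgebraic ℚ b₂ →
      Θ (b₁ + b₂) s - Θ b₁ s - Θ b₂ s ∈ M₁)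
    {ι : Type*} (J : Finset ι) (c : ι → PeriodSymbol →₀ ℂ)
    (hc : ∀ j ∈ J, ∀ s, IsAlgebraic ℚ (c j s)) :
    πM₁ ((∑ j ∈ J, c j).sum fun s b => Θ b s) = ∑ j ∈ J, πM₁ ((c j).sum fun s b => Θ b s) := by
  classical
  induction J using Finset.induction_on with
  | empty => simp
  | insert j J hj ih =>
    rw [Finset.sum_insert hj, Finset.sum_insert hj,
      mk_sum_add Θ hΘ0 hΘadd _ _ (hc j (Finset.mem_insert_self j J))
        (isAlgebraic_finset_sum_apply J c fun k hk => hc k (Finset.mem_insert_of_mem hk)),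
      ih fun k hk => hc k (Finset.mem_insert_of_mem hk)]

/-- **Formal sums with repeated symbols.** If `c = Σ_{j ∈ J} bⱼ • δ_{sⱼ}` with algebraic `bⱼ`
(the `sⱼ` need not be distinct), then the class of `Σ_{s ∈ supp c} Θ (c s) s` is
`Σⱼ πM₁ (Θ bⱼ sⱼ)`. This is how each elementary relation is fed to `Θ`. [folklore] -/
theorem mk_sum_of_eq_sum_smul_single (hΘ0 : ∀ s, Θ 0 s ∈ M₁)
    (hΘadd : ∀ (s : PeriodSymbol) (b₁ b₂ : ℂ), IsAlgebraic ℚ b₁ → IsAlgebraic ℚ b₂ →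
      Θ (b₁ + b₂) s - Θ b₁ s - Θ b₂ s ∈ M₁)
    {ι : Type*} (J : Finset ι) (b : ι → ℂ) (σ : ι → PeriodSymbol)
    (hb : ∀ j ∈ J, IsAlgebraic ℚ (b j)) (c : PeriodSymbol →₀ ℂ)
    (hc : c = ∑ j ∈ J, b j • Finsupp.single (σ j) (1 : ℂ)) :
    πM₁ (c.sum fun s b => Θ b s) = ∑ j ∈ J, πM₁ (Θ (b j) (σ j)) := by
  rw [hc, mk_sum_finset_sum Θ hΘ0 hΘadd J _ fun j hj s => isAlgebraic_smul_single_apply (hb j hj) _ _]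
  exact Finset.sum_congr rfl fun j _ => mk_sum_smul_single Θ hΘ0 (b j) (σ j)

/-- **Criterion for the retraction to kill a `ℚ̄`-combination of relations**: if for every
relation `ρₗ` and every algebraic multiplier `a`, the combination `a • ρₗ` has algebraic
coefficients and `πM₁ (Σ_s Θ ((a • ρₗ) s) s) = 0`, then `Σₗ aₗ • ρₗ` is killed.
[cite: HuberWustholz2022, Thm 13.3 (2)] -/
theorem sum_mem_M₁_of_forall (hΘ0 : ∀ s, Θ 0 s ∈ M₁)
    (hΘadd : ∀ (s : PeriodSymbol) (b₁ b₂ : ℂ), IsAlgebraic ℚ b₁ → IsAlgebraic ℚ b₂ →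
      Θ (b₁ + b₂) s - Θ b₁ s - Θ b₂ s ∈ M₁)
    {k : ℕ} (ρ : Fin k → (PeriodSymbol →₀ ℂ)) (a : Fin k → ℂ)
    (halg : ∀ l s, IsAlgebraic ℚ ((a l • ρ l) s))
    (hkill : ∀ l, πM₁ ((a l • ρ l).sum fun s b => Θ b s) = 0) :
    ((∑ l, a l • ρ l).sum fun s b => Θ b s) ∈ M₁ := by
  rw [← mk'_eq_zero_iff, mk_sum_finset_sum Θ hΘ0 hΘadd Finset.univ _ fun l _ s => halg l s]
  exact Finset.sum_eq_zero fun l _ => hkill l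

end Extension

end RetractionAlgebra

/-- HELPER ANCHOR of this file (registered on stmt-KontsevichZagierPeriods-10042): a representation
with vanishing integrand lies in `M₁`. [cite: KontsevichZagier2001, §1.2 rule (1)] -/
theorem helper_retractionAlgebra_zero : ∀ {n : ℕ} (r : KZ.IntegralRep n), (∀ x ∈ r.domain, r.integrand x = 0) → KZ.of r ∈ M₁ :=
  fun r h => HomotopyInvariance.of_mem_of_integrand_zero r h

end Summit.KontsevichZagierPeriods.SymplecticScissors.RealOnePeriodRelations

end
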